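import Summits.Ventures.Crystal3D.Theorems.StickyWulffConstantTextureLiminfTexShadowFluxPairSteerTilt
import Summits.Ventures.Crystal3D.Theorems.StickyWulffConstantTextureLiminfTexShadowEdgeOnRepCover
import HarnessLib

/-!
# TexShadow row (e) / EDGE-ON flux class: the flux-pair sliver lies in {both plates within 13° of edge-on} — `FluxPairFailAt` corollaries
# (lane T, crux `TextureLiminfV5`, stmt-Ventures-23912, registered stub `stub_edgeOnFlux`; cf-p1 (cxcvii)(a)/(cciv) L4; 19480-p1 g16)

HONEST FRAMING. Venture `Summits/Ventures/Crystal3D` (cell `crystal3d-full`), route `route-Ventures-StickyWulffConstant`, helper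
`--supports` the law-v5 crux `TextureLiminfV5` (stmt-Ventures-23912).  Logic on top of '…FluxPairSteerTilt' (p7133xx) and 19480-p2's
'…EdgeOnRepCover' (`FluxPairFailAt`, `WeakPlateAt`, `IsRep`); no certificate, no walker, no wall law; rung F-C1 not moved.

* `weakPlateAt_sharp_of_fluxPairFailAt` — a flux-pair failure forces BOTH plates weak at threshold `√2·c₀ − √3/6` (improves the typed floor `1/4` of
  `weakPlateAt_of_fluxPairFailAt` to the geometric floor `√3/6 = 1/(2√3)` of `exists_rep_steerLaunch_floor`);
* **`inner_axis_sq_lt_of_fluxPairFailAt`** — at `c₀ = 13/25`: `FluxPairFailAt (13/25) σ₁ σ₂ L₁ L₂ → ⟪L₁ e₃, e₃⟫² < 1/20 ∧ ⟪L₂ e₃, e₃⟫² < 1/20` (both plate axes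
  within `arcsin √(1/20) ≈ 12.9°` of the wall plane; in particular `> 54.7°` from the normal, so the in-layer rows of both plates are `RowSteep` and rise by
  `≥ 3/4`, p713118).
WHAT THIS IS NOT: not a payer for the sliver; F-C1 not moved.
-/

noncomputable section

open scoped BigOperators InnerProductSpace

namespace Summit.Ventures.Crystal3D.Cruxes.TextureLiminf.TexShadow

open Summit.Ventures.Crystal3D Summit.Ventures.Crystal3D.Theorems
open Literature.MathematicalPhysics.StatisticalMechanics (IsHaggSeq basalMirror)

/-- A frame from `{L, twinRepFrame L}` with the matching word is a presentation. -/
theorem isRep_of_frame_choice {σ : ℤ → ℤ} {L F : E3 ≃ₗᵢ[ℝ] E3} (hF : F = L ∨ F = twinRepFrame L) :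
    ∃ τ : ℤ → ℤ, IsRep σ L τ F := by
  rcases hF with rfl | rfl
  · exact ⟨σ, isRep_self σ _⟩
  · exact ⟨fun n => -σ n, isRep_twinRep σ L⟩

/-- **A flux-pair failure forces BOTH plates weak at threshold `√2·c₀ − √3/6`.** -/
theorem weakPlateAt_sharp_of_fluxPairFailAt {c₀ : ℝ} {σ₁ σ₂ : ℤ → ℤ} {L₁ L₂ : E3 ≃ₗᵢ[ℝ] E3} (h : FluxPairFailAt c₀ σ₁ σ₂ L₁ L₂) :
    WeakPlateAt (Real.sqrt 2 * c₀ - Real.sqrt 3 / 6) σ₁ L₁ e₃ ∧ WeakPlateAt (Real.sqrt 2 * c₀ - Real.sqrt 3 / 6) σ₂ L₂ (-e₃) := by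
  have hne : ‖(-e₃ : E3)‖ = 1 := by rw [norm_neg, norm_e₃_eq_one]
  obtain ⟨F₂', hF₂', v₂', z₂', -, hL₂', hfl₂⟩ := exists_rep_steerLaunch_floor L₂ hne
  obtain ⟨τ₂', hr₂'⟩ := isRep_of_frame_choice (σ := σ₂) hF₂'
  obtain ⟨F₁', hF₁', v₁', z₁', -, hL₁', hfl₁⟩ := exists_rep_steerLaunch_floor L₁ norm_e₃_eq_one
  obtain ⟨τ₁', hr₁'⟩ := isRep_of_frame_choice (σ := σ₁) hF₁'
  constructor
  · intro τ₁ F₁ hr₁ z₁ v₁ hl₁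
    obtain ⟨i, j, hlt⟩ := h τ₁ τ₂' F₁ F₂' hr₁ hr₂' z₁ v₁ z₂' v₂' hl₁ (hL₂' τ₂')
    exact ⟨i, by linarith [hfl₂ (upWord F₂' τ₂' (-e₃)) j]⟩
  · intro τ₂ F₂ hr₂ z₂ v₂ hl₂
    obtain ⟨i, j, hlt⟩ := h τ₁' τ₂ F₁' F₂ hr₁' hr₂ z₁' v₁' z₂ v₂ (hL₁' τ₁') hl₂
    exact ⟨j, by linarith [hfl₁ (upWord F₁' τ₁' e₃) i]⟩

/-- **THE SLIVER IS NEARLY EDGE-ON ON BOTH SIDES**: at the law-v5 charge `c₀ = 13/25`, a flux-pair failure forces `⟪L₁ e₃, e₃⟫² < 1/20` and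
`⟪L₂ e₃, e₃⟫² < 1/20` (both plate axes within `≈ 12.9°` of the wall plane). -/
theorem inner_axis_sq_lt_of_fluxPairFailAt {σ₁ σ₂ : ℤ → ℤ} {L₁ L₂ : E3 ≃ₗᵢ[ℝ] E3} (h : FluxPairFailAt (13 / 25) σ₁ σ₂ L₁ L₂) :
    ⟪L₁ e₃, e₃⟫_ℝ ^ 2 < 1 / 20 ∧ ⟪L₂ e₃, e₃⟫_ℝ ^ 2 < 1 / 20 := by
  have hne : ‖(-e₃ : E3)‖ = 1 := by rw [norm_neg, norm_e₃_eq_one]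
  constructor
  · by_contra hcon
    have htilt : 1 / 20 ≤ ⟪L₁ e₃, e₃⟫_ℝ ^ 2 := le_of_not_gt hcon
    obtain ⟨F₁, F₂, hF₁, hF₂, v₁, z₁, v₂, z₂, hL₁, hL₂, hsum⟩ := exists_rep_launches_sum_ge_of_tilt L₁ L₂ htilt
    obtain ⟨τ₁, hr₁⟩ := isRep_of_frame_choice (σ := σ₁) hF₁
    obtain ⟨τ₂, hr₂⟩ := isRep_of_frame_choice (σ := σ₂) hF₂
    obtain ⟨i, j, hlt⟩ := h τ₁ τ₂ F₁ F₂ hr₁ hr₂ z₁ v₁ z₂ v₂ (hL₁ τ₁) (hL₂ τ₂)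
    exact absurd (hsum (upWord F₁ τ₁ e₃) (upWord F₂ τ₂ (-e₃)) i j) (not_le.2 hlt)
  · by_contra hcon
    have htilt : 1 / 20 ≤ ⟪L₂ e₃, -e₃⟫_ℝ ^ 2 := by
      rw [inner_neg_right, neg_sq]; exact le_of_not_gt hcon
    -- plate 2 strong toward −e₃, plate 1 at the floor toward e₃
    obtain ⟨F₂, hF₂, v₂, z₂, -, hL₂, -, -, h₂⟩ := exists_rep_steerLaunch_sharp_of_tilt L₂ hne htilt
    obtain ⟨F₁, hF₁, v₁, z₁, -, hL₁, h₁⟩ := exists_rep_steerLaunch_floor L₁ norm_e₃_eq_one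
    obtain ⟨τ₁, hr₁⟩ := isRep_of_frame_choice (σ := σ₁) hF₁
    obtain ⟨τ₂, hr₂⟩ := isRep_of_frame_choice (σ := σ₂) hF₂
    obtain ⟨i, j, hlt⟩ := h τ₁ τ₂ F₁ F₂ hr₁ hr₂ z₁ v₁ z₂ v₂ (hL₁ τ₁) (hL₂ τ₂)
    have := sqrt_two_mul_c0_le_sharp_add
    linarith [h₁ (upWord F₁ τ₁ e₃) i, h₂ (upWord F₂ τ₂ (-e₃)) j]

end Summit.Ventures.Crystal3D.Cruxes.TextureLiminf.TexShadow

end
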